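import Summits.BirchSwinnertonDyer.Rank1Residual.Additive.CensusX41Calibration
import Literature.NumberTheory.EllipticCurves.PAdicHeights
import Literature.NumberTheory.EllipticCurves.BSDRootNumberSmallConductorProofs
import Literature.Barriers.BirchSwinnertonDyer.ExceptionalZero
import HarnessLib

/-!
# Census relation X4-2 (bsd-formula-census, additive `p`, locus SubSemistableTwist, RANK ONE), TYPED:
# the `χ_{p*}`-branch DERIVATIVE of `L_p(E♭)` versus the twist-transported cyclotomic height —
# `A′ = α♭⁻¹ · c_∞(E) · h(P) · #Ш_an∏c/#T²` in PARI's normalisations (cell `b2b-bsdres`, census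
# cell, seat `b2b-bsdres-census-ctyper1` = conjecture-typer 1, gen 2; routing H-4; RESIDUAL-MAP O7-ord)

HONEST FRAMING (cell `b2b-bsdres`, run/shared/lean/b2b/bsd-rank1-residual/, verbatim in every
file): the goal of the cell is to DELETE the COMBINATION-SHAPED residual classes of the
Birch–Swinnerton-Dyer formula for ALL analytic-rank `≤ 1` elliptic curves over `ℚ` — "full BSD
formula for every rank `≤ 1` curve in class `C`" assembled STRICTLY from published theorems — so
that the rank-`≤ 1` remainder becomes exactly the CONSTRUCTION-SHAPED classes, which are TYPED
(missing-input `Prop`s), NOT attempted. This is not "finishing BSD". Census cell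
(bsd-formula-census; lead `cp-bsdcensus`, census-lead, typers `census-ctyper1/2`, referee
`b2b-bsdres-ref-3`): research instrumentation; census output = EVIDENCE / conjecture items for the
kernel cell, never a Literature fact; LABELS OF RECORD: `r = 0` cells CALIBRATION (X4-1, PROVED in
`CensusX41Calibration.lean`), `r = 1` cells CANDIDATE = EVIDENCE for the typers, never a cited fact;
nothing here 'confirms' anything; labels / RESIDUAL-MAP marks UNCHANGED; nothing booked. One
`@[conjecture]` predicate (nothing asserted) and theorems; no named fact.

## What the census measured (files of record; PARI/GP 2.17.2 normalisations)

`run/shared/lean/ttrl/bsd-formula-census/X42-REPORT.md`, VERDICT OF RECORD (2026-08-21T06:10:08Z,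
cp-bsd-w2; sha256 `e8592c9a2e1a59c13e754928288c9f6b1ce554f7ffb80b93db3c55aa7f5e9950`, 18 301 B;
Engine C review cp-bsdcensus ACCEPT-WITH-NOTES, PLAN.md DRAFT 39 §11; relayed by ttrl3 06:16Z),
pre-registered in `PLAN.md` §4 'X4-2 FIT PRE-REGISTRATION' (DRAFT 28, 2026-08-21T04:49Z, before any
ratio was formed; no criterion amended; landing condition met by census-lead WAIVER requests.jsonl
l.1415, quoted in the report §0); fit `x42/N3000/fit_j122221/FIT.json` (sha256 `bc80e56e08eb6dbb…`),
per-row table `X42_rows.tsv`, bundle `main.py` sha256 `f735b1bc…` = engine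
`harness/engines/ttrl/bsdc_x42_fit_job.py` commit 8d7e0a38 (kit j122221, 37 s); inputs
`x42/N3000/{height_j119766_out.jsonl, height_j120033_rerun_out.jsonl, aprime{0,1,2}_*.jsonl,
cols_j120045_out.jsonl}` + `x41/N3000/x41shard*_pairs_out.jsonl`; STEP-0 `X42-STEP0.md` (sha256
`57430f67…`); LEADERBOARD.jsonl rows 10–11 (sha256 `9d9733a8…` at relay), config hashes
`d256dfff9e867754` (M) / `813ccc7836d9197d` (Gord2), status "claimed — CANDIDATE" until a second seat
re-scores from the config hash. UNIVERSE: Cremona curves `#1`, `N ≤ 3000`, analytic rank `1`,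
`p ∈ {3,5,7,11,13}` with `v_p(N) = 2` and semistable twist `E♭ = E ⊗ χ_{p*}` — (M) `E♭`
multiplicative 558 pairs, (G-ord, `e = 2`) `E♭` good ordinary 141 pairs (+1 set aside: 1827a1@3,
2 digits); `p = 3`: 451 · `5`: 151 · `7`: 63 · `11`: 21 · `13`: 13; 453 train / 246 held-out by the
`sha256(label|p)` split; `#Ш_an = 1` on ALL rows. Per pair: `A′ = ellpadicL(E♭, p, n, [0,(p−1)/2], 1)`
(the `s`-derivative at `s = 0` of the `χ_{p*}`-branch; second engine = own twisted Riemann-sum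
derivative, agreement at absolute precision `p^{K−1}` on 687/687 informative rows, 13 uninformative
rows listed, 0 disagreements; `A′ ≠ 0` on 700/700, branch VALUE `O(pⁿ)` on 700/700),
`h(P) = a − c_E·b`, `[a,b] = ellpadicheight(E_min, p, 16, (p·c_p)P)/(p·c_p)²` on the Cremona REDUCED
minimal model, `P` the Cremona generator, `c_E = U²·s₂(E♭_min) − R` transported from the twist
(`c_E(p*) = c_E(−p*)` 700/700; second engine = own σ-function height, `h = −2p·H` on 700/700; own
Tate-`E₂` = `ellpadics2` to `O(p¹⁶)` on 558/558 (M) rows; on Gord2 the unit-root input was PARI's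
`ellpadics2` alone AT THE FIT — caveat n3, STRUCK at the re-stamp below), `h ≠ 0` on 700/700,
`C = #Ш_an∏c_ℓ/#T²` (Cremona `allbsd`). BLIND fit of `R := A′/(h·C)` over the pre-registered
dictionary: ONE alias class per locus, minimal representative **`R = α♭⁻¹·c_∞(E)`** — (M) train
360/360, held-out 198/198 (min 4 resp. 5 digits); Gord2 train 93/93, held-out 48/48 (min 5 digits);
every other member 0/558 ‖ 0/141; integrality `v_p(A′) = v_p(h) + v_p(C)` 700/700; controls:
reduced dictionary ⇒ 0 survivors, 10 % corruption ⇒ 328 = 360 − 32 and 81 = 93 − 12 exact; the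
`a(E,p) = 1` (42) and `a = 0` (99) Gord2 subsets fitted by the SAME survivor (no `ℓ_p`-type factor,
no `p`-power). CAVEATS CARRIED (verbatim duty): label EVIDENCE — CANDIDATE, nothing 'confirms';
`#Ш` exponent UNDETERMINED (`#Ш_an ≡ 1`; pre-registered shape `#Ш_an¹` typed below); the
Delbourgo/Disegni comparison constant is NOT settled by the fit; `N ≤ 3000` discovery only;
caveat n3 (Gord2 unit-root input single-engine) STRUCK and the second score from the config hash
DONE (REPRODUCED) — both recorded in § 'Evidence update' below (doc-only re-stamp).

## Evidence update (doc-only re-stamp 2026-08-21T10:08Z; declarations byte-identical)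

SECOND SCORE DONE: LEADERBOARD.jsonl rows 13–14 (2026-08-21T09:52:53Z; file sha256 `a12b2f7c…`),
same config hashes `d256dfff9e867754` (M) / `813ccc7836d9197d` (Gord2), status "REPRODUCED —
CANDIDATE / EVIDENCE" (review cp-bsdcensus2; supersedes the status of the 'claimed' rows 10–11):
second seat cc-eng-1 GEN 2 re-scored from the config hash with its own `p`-adic arithmetic
(HOME `class-closure/eng-1/`: `code/x42_rescore.py` 34c8e7c3, `out/x42_rescore_cceng1.json`
9ecb0297, `X42-RESCORE-cceng1.md` b647156f): loci (M) 360/360 + 198/198, Gord2 93/93 + 48/48,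
corruption 328 ‖ 81, per-row 699/699 with 0 mismatches (split, locus, survivor bit, `v_h`, `v_C`,
`ã`); ablations die (`α♭⁻¹` alone 375/558 ‖ 93/141, `c_∞` alone 281/558 ‖ 0/141, constant
188/558 ‖ 0/141; `α♭·c_∞` 558/558 on (M) = the documented alias `α♭² = 1`); exponent scans: only
`j = 0`. CAVEAT n3 STRUCK (`X42-ENGB-NOTE.md` v2, cp-bsd-w2 2026-08-21T09:59:18Z, sha256
`09e868c8…`; Engine C lead review ACCEPT, `PLAN.md` DRAFT 45 §10; relayed by ttrl3 10:03Z) and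
REPLACED by: 'unit-root input `s₂`: ≥ 2 independent engines on every fitted row — Gord2 141/141
(93 @3 ENG-B3 isotower `engb3_x42_gord2.json` 7b597c1b; 48 @ `p ≥ 5` Kedlaya
`x42_gord2_s2_kedlaya.json` 86bfec4b AND isotower); (M) 558/558 three engines (PARI `ellpadics2`,
W2 own Tate-`E₂`, cc-eng-1 PARI-free Tate `x42_heightK_mult.json` d7df5f6d); heights two-engine
plus cc-eng-1's K-height `ρ = 1` on 558/558 (M) and 140/140 non-CM Gord2; waiver (2): no
disagreement, nothing frozen'. HEIGHT IDENTIFICATION (EVIDENCE; cc-eng-1 GEN 2/3 reports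
`X42-HEIGHTK-cceng1.md` aac57af8f27a3170, `X42-HEIGHTK-M-cceng1.md` b334d50d32c0968a):
`h_PARI(P)` at the additive O7-ord prime equals `[K:ℚ]⁻¹ ×` the Mazur–Tate/Schneider height of
the same point over `K = ℚ(√p*)` at the ramified semistable prime, ratio `ρ = 1` to every printed
digit on all 698 computed rows (140 non-CM Gord2 + 558 (M): 281 split / 277 non-split) — the
numerical shadow of rmap-2 §D addenda 9/10 (`κ_h = −1` reading); a READING, never asserted here.
DISEGNI SCOPE (page-read, arXiv:1510.02114): Thm. B (= arXiv Thm. 2, p. 8) is a `p`-adic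
Gross–Zagier formula for Heegner points on a modular abelian variety `A/F` (`F` totally real) with
POTENTIALLY `𝔭`-ORDINARY good or semistable reduction at every `v ∣ p` (abstract p. 2; CM
extension `E/F` with `E_v/F_v` split, `χ` not exceptional): it covers the curve `E/ℚ` ITSELF at
an additive potentially-ordinary prime ((G-ord) and (M) alike), not only `E♭`; its analytic side
is Disegni's `L_{p,α}(σ_{A,E})` differentiated in the cyclotomic variable, and the comparison of
that object with the MTT `χ_{p*}`-branch of `f♭` (PARI's `A′`) is the part NOT in print (n1011
`DisegniDelbourgoComparisonAt`; RESIDUAL-MAP O7-ord). REMAINING CAVEATS: `#Ш` exponent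
undetermined (`#Ш_an ≡ 1`); Delbourgo/Disegni comparison constant open; `N ≤ 3000` discovery of
the pinned UNIT `α♭⁻¹·c_∞(E)` — the VALUATION content `v_p(A′) = v_p(h) + v_p(C)` alone is extended
to `N < 2·10⁴` by the X4-2 WINDOW (§ 'Window extension' below; requests l.1502 (a) DONE). Label of
record unchanged: EVIDENCE — CANDIDATE (REPRODUCED); nothing 'confirms'; nothing booked.

## Window extension (doc-only re-stamp 2026-08-21T13:30Z, gen 7; declarations byte-identical)

X4-2 WINDOW `run/shared/lean/ttrl/bsd-formula-census/X42-WINDOW.md` (cp-bsd-w2, 2026-08-21T10:35:20Z,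
sha256 `a10a170979128fde17cf31b1704581a6d978f587434da820ed86243fc49ef835`, 7 684 B; per-pair table
`x42/window/X42_window_valuations.tsv` sha256 `3a31299352f404150bc3121f576e01cc680e3a1caf74ee5a2edd6424fc01e7b5`,
45 781 B; `x42/window/SHA256SUMS` 9f466d88…; record `PLAN.md` §11; Engine C lead review cp-bsdcensus2
ACCEPT, recomputed from the TSV; relayed by ttrl3 10:38Z). PREDICTION RULE stated in its §0 before
the numbers: `v_pred = v_p(h) + v_p(#Ш_an·∏c/#T²)` with `v_p(h)` = rmap-2's certified height column
(`o7h_fold2_rmap2g7_cert.tsv.gz` d30e1cbe…, column `vh_A`) and the quotient from Cremona `allbsd`.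
UNIVERSE: the 429 rank-one O7-ord pairs with `N < 2·10⁴` in cells (M) 287 / Gord3 128 / Gord_e2 14
(`p = 3`: 397, `p = 5`: 32; X3 382 / X4 47; `N < 10⁴`: 227; twist level `≤ 6 600`); the 13 Gord_e346
window rows are NOT run (no quadratic-twist `A′`; W1 / ENG-D territory); `N ≥ 2·10⁴` stays the ENG-D
route. RESULT: `v_p(A′) = v_pred` on 429/429, two engines — PARI `mspadicL` (`≡ ellpadicL` 59/59 on
STEP-0′ j129242; `A′ ≠ 0` with `≥ 3` unit digits beyond `v` at `n = v+5`) and W2's own twisted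
Riemann sum at level `p^{v+4}` certifying `v` independently (`B ≡ A′ mod p^{K−1}`, `K−1 > v`)
429/429; pass 1 (`n = v+2`) `≡` pass 2 429/429 (one disclosed `n = 16` rerun 19620o1@3, `v = 7`);
`v_p(A′)` distribution `p = 3`: 1:287 2:75 3:24 4:8 5:2 7:1, `p = 5`: 1:28 2:4, no zeros; `Ш_an = 1` on
all 429 (`#Ш` exponent still UNDETERMINED); STEP-0′: the 51 `N ≤ 3000` residue rows reproduce W2's
`n = 16` valuations 51/51 + 8 window probes 8/8; shards j129622 (215) + j129623 (214) disjoint;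
scripts commits 6fc66aeb / 9d5fbc3c; ≈ 0.9 core-h. LABEL: EVIDENCE — per-pair VALUATION
certificates (RESIDUAL-MAP O7-ord §D/§E EVIDENCE LINE 4); the unit `α♭⁻¹·c_∞(E)` is NOT measured
on the window, so the window instances the VALUATION SHADOW of `RelationAt` — typed (gen 6) as
`CensusX42.ValRelationAt W p Dh` in `CensusX42ValRelation.lean` (`valRelationAt_of_relationAt`;
same `(V, C, f, ϖ, s)`-frame, clauses `L(0) = 0`, `[T¹]L ≠ 0`,
`‖ϖ·[T¹]L·log_p(γ_cyc)·#T²‖_p = ‖s·Reg_p(E,Dh)·∏c‖_p`) — not `RelationAt` itself. DOWNSTREAM OF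
THIS FILE (this seat, gens 2–6; all landed; nothing asserted about any curve in any of them): exact
grade `CensusX42Height` (the census height as ONE predicate `IsTwistSigmaHeight`,
`RelationAtCensusHeight`), `CensusX42Bridge`/`Bridges` (⟹ n1011-p01's typed
`BranchPAdicGrossZagier[∅|Odd|Mult]At`, Schneider rider, weak certificate), `CensusX42BSD` /
`BSDCorollaries` / `BSDMult` / `BSDIMC` / `UnitRows` (relation AT THE PAIR + published half ⟹
`BSDp` one-nodes), `CensusX42CoeffValuation` (KURREG column `vReg_x42(v₁)`),
`CensusQ6RankOneInterlock`, `CensusKurregRecordRows[Three]`; window grade `CensusX42ValRelation` /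
`ValBridges` / `ValCoeffValuation` / `ValUnitRows` / `ValConverse` (`ValRelationAt ⟺` Schneider `∧`
p01's typed branch p-adic Gross–Zagier on (G-ord)/(M) rows) / `ValLoops`. KERNEL READING carried
(gen 6, no booking): every consumer uses `RelationAt` only through `ValRelationAt`; the pinned unit is
surplus to the kernel.

## Dictionary PARI ↔ tree (= X4-1's, `CensusX41Calibration.lean`, plus the derivative)

`V = E♭` globally minimal, `f = f♭` its newform, `W = E`; PARI `x⁺({∞→r}) = ϖ·c_∞(V)·[r]⁺_f`,
`x⁻({∞→r}) = ϖ⁻·[r]⁻_f` (`ϖ·Ω(V) = Ω⁺_f`, `ϖ⁻·|Ω⁻(V)| = Ω⁻_f`); PARI's `ellpadicL(E♭,p,n,[0,i])`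
is the value at the trivial character of the `ω^i`-branch of the measure built from `x^{sgn}`, so
(X4-1, checked 1552/1552) `A = ϖ·c_∞(V)·L(0)` (even) resp. `ϖ⁻·L⁻(0)` (odd) for the tree branches
`L = padicLFunctionBranch f α♭ (p/2)` / `L⁻ = padicLFunctionMinusBranch …` ((M): the one-term
`…BranchMult` twins with `α♭ := ã = a_p(V) = ±1`); PARI's derivative is in `s` with
`T = γ_cyc^s − 1`, so `A′ = ϖ·c_∞(V)·[T¹]L·log_p(γ_cyc)` (even) resp. `ϖ⁻·[T¹]L⁻·log_p(γ_cyc)`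
(odd) (`padicLog`, `cyclotomicGenerator`; census-lead H1-BRIEF D1–D7 / X11b-1 `κ_h = 1`
concordance); `c_∞(V) = c_∞(E)` (700/700; tree `numRealComponents_eq_of_twist`); `#Ш_an = shaAn W`,
`∏c = W.tamagawaProduct`, `#T = W.torsionOrder`, `h(P) = Reg_p(E, Dh) = padicRegulator Dh` (rank 1,
Cremona generator) for the height datum `Dh` of the census. Dividing the survivor by `c_∞` and
clearing `C·#T²`: EVEN rows `ϖ·[T¹]L·log_p(γ_cyc)·#T² = α♭⁻¹·#Ш_an·Reg_p(E,Dh)·∏c`; ODD rows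
`ϖ⁻·[T¹]L⁻·log_p(γ_cyc)·#T² = α♭⁻¹·c_∞(E)·#Ш_an·Reg_p(E,Dh)·∏c` — the clauses of `RelationAt`.
THE HEIGHT: the census's `h` is the cyclotomic Mazur–Tate sigma height of `E` at the ADDITIVE prime
with the unit-root splitting transported from `E♭` (`h_PARI = −(2/m²)·log_p(σ_{s₂}(mP)/d(mP))`,
X42-STEP0 §4; Stein–Wuthrich sign, `= −2p ×` MST's `h_p`). The tree's `PAdicHeightData.IsCanonical`
/ `cyclotomicPAdicHeight` are GOOD-ORDINARY objects and `PAdicHeightDataK.IsCanonical` wants `p`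
split in `K`, so this datum is NOT yet a tree term: `RelationAt W p Dh` takes `Dh` as a PARAMETER
(as additive-p2's `CycCharLeadingTermOneAt W p Dh` does); typing "the twist-transported sigma
height" as ONE predicate on `Dh` (Mazur–Tate pair of `W ⊗ ℚ_p` with the ODE constant transported
from `V`'s `padicSigmaConst` along `C` and `√p*`) was the typer's next item (X42-m1) — DONE in
`CensusX42Height.lean` (`IsTwistSigmaHeight W p V Dh`, `@[conjecture] RelationAtCensusHeight W p`,
bridge `relationAt_of_relationAtCensusHeight`), the intended instance of `RelationAt W p Dh`.

## What is in print and what is not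

PRINTED ANTECEDENTS: Delbourgo, Compositio 113 (1998) §2.5 BS-D(p)(i)(ii) — the CONJECTURE
(order of vanishing = rank; leading term with Delbourgo's `Reg_p = [K:ℚ]⁻¹⟨,⟩^{Sch}_{p,K}`,
`K ⊂ ℚ(μ_p)` the semistabilising field, here `K = ℚ(√p*)`); Delbourgo, JNT 95 (2002) Thm. (A)(B) —
the ALGEBRAIC leading term (tree fact `Delbourgo2002.mainTheorem`, `LeadingTermClauses W p Dh`,
reading note on `ℓ_p`); Disegni, Compositio 153 (2017) Thm. B — `p`-adic Gross–Zagier under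
potentially `𝔭`-ordinary reduction (scope: § 'Evidence update'); Mazur–Tate–Teitelbaum 1986 §I.13 (branches), §II (p-adic BSD); the `r = 0`
companion X4-1 = Birch × Pal × Gauss × MTT (PROVED). NOT IN PRINT: any numerical or theoretical
statement equating `A′` with a multiple of `h(P)·C` at an ADDITIVE prime — the comparison constant
between Disegni's/Delbourgo's normalisations and PARI's branch is RESIDUAL-MAP O7-ord's open
comparison; the census pins it to `α♭⁻¹` (no `ℓ_p`, no Gauss sum, no power of `p`) on 699/699.
GENUINELY CONJECTURAL in `RelationAt`: the identity itself (CANDIDATE), the `#Ш_an` exponent `1`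
(untested: `#Ш_an ≡ 1`), and `[T¹]L ≠ 0` ⟺ `Reg_p(E,Dh) ≠ 0` (Schneider non-degeneracy for THIS
height; certified per pair 700/700; class-wide = barrier `PAdicHeightNondegeneracy`). PROVED here:
`L(0) = 0` on every row (§2, from X4-1 and `L(E,1) = 0`), and the equivalence `[T¹]L ≠ 0 ⟺ Reg_p ≠ 0`
given the identity. KERNEL READING (no booking): composed with a branch divisibility-as-equality
(additive-p4's `ChiBranchDivisibilityAt`-shape inputs transported by [C]), `RelationAt W p Dh` is the
"analytic `p`-adic BSD leading term in classical currency" factor of additive-p2's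
`CycCharLeadingTermOneAt W p Dh` with the unit PINNED (`u = α♭⁻¹` up to the divisibility's unit),
since `#Ш_an·∏c/#T² = L′(E,1)/(Ω_E·Reg_∞)` by definition of `shaAn`.

Contents: §1 `@[conjecture] CensusX42.RelationAt W p Dh`; §2 theorems
`constantCoeff_branch_eq_zero_of_good`, `constantCoeff_branchMult_eq_zero`,
`constantCoeff_minusBranch_eq_zero_of_good`, `constantCoeff_minusBranchMult_eq_zero` (the clause
`L(0) = 0`), `coeff_one_ne_zero_iff_padicRegulator_ne_zero`.

References: D. Delbourgo, Compositio Math. 113 (1998) §2.5 [Delbourgo1998]; D. Delbourgo, J. Number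
Theory 95 (2002) Thm. (A), (B) [Delbourgo2002]; D. Disegni, Compositio Math. 153 (2017) Thm. B;
B. Mazur, J. Tate, J. Teitelbaum, Invent. Math. 84 (1986) §I.13, §II [MazurTateTeitelbaum1986Invent];
B. Mazur, W. Stein, J. Tate, Doc. Math. Extra Vol. (2006) §1 [MazurSteinTate2006]; W. Stein,
C. Wuthrich, Math. Comp. 82 (2013) §4.1 [SteinWuthrich2013]; A. Pal, Proc. AMS 140 (2012) Thm. 3.2
[Pal2012]; The PARI Group, PARI/GP 2.17.2 (`ellpadicL`, `ellpadicheight`, `ellpadics2`); census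
files above; HOME/b2b-bsdres-census-ctyper1/X43-TYPING-PREP.md §5 (gen-1 pointers for X4-2).
-/

noncomputable section

open scoped Classical MatrixGroups ModularForm

open CongruenceSubgroup WeierstrassCurve Literature.NumberTheory.EllipticCurves
  Literature.NumberTheory.EllipticCurves.ModularForms
  Literature.NumberTheory.EllipticCurves.Rank1Residual
  Literature.Barriers.BirchSwinnertonDyer

namespace Summit.BirchSwinnertonDyer.Rank1Residual.Additive

namespace CensusX42

/-! ### §1 The typed census relation X4-2 (rank one, additive `p`, semistable twist) -/

/-- **Census relation X4-2, TYPED** (see module docstring for EVIDENCE, DICTIONARY, caveats).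
For `E = W` globally minimal, a prime `p`, and a `p`-adic height datum `Dh` on `E(ℚ)` — INTENDED:
the cyclotomic Mazur–Tate sigma height of `E` at the additive prime `p` with the unit-root splitting
TRANSPORTED from the semistable twist `E♭` along the `ℚ(√p*)`-isomorphism (PARI 2.17.2
`ellpadicheight` components `h = a − c_E·b`, `c_E = U²·s₂(E♭_min) − R`; `= −2p ×` W2's own
σ-height; Stein–Wuthrich sign convention), which is NOT yet a tree object, so `Dh` is a PARAMETER
exactly as in `CycCharLeadingTermOneAt W p Dh` — : WHENEVER `W` is additive at `p`, `ℚ`-isomorphic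
(`C • V^{(p*)} = W`) to the twist by `p* = ±p ≡ 1 (mod 4)` of a globally minimal `V = E♭` good or
multiplicative at `p` with newform `f = f♭`, and `ord_{s=1} L(E,s) = 1`, then for `#Ш_an(E) = s`:
* rows `p ≡ 1 (mod 4)` (even branch `ω^{(p−1)/2} = χ_p`; `ϖ·Ω_V = Ω⁺_f`): (i_G) if `V` is good
  ORDINARY at `p` with unit root `α♭`, the `χ_p`-branch `L = L_p(f, α♭, ω^{(p−1)/2}, T)` has
  `L(0) = 0`, `[T¹]L ≠ 0`, and
  `ϖ · [T¹]L · log_p(γ_cyc) · #E(ℚ)_tors² = α♭⁻¹ · s · Reg_p(E, Dh) · ∏_v c_v`;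
  (i_M) if `V` is multiplicative at `p` (`ã = a_p(V) = ±1`), the same for the one-term branch
  `L⁺_p(f, ã, ω^{(p−1)/2}, T)` with `α♭ := ã`;
* rows `p ≡ 3 (mod 4)` (odd branch; `ϖ⁻·|Ω⁻(V)| = Ω⁻_f`): (ii_G)/(ii_M) the same for the minus
  branches with the factor `c_∞(E) ∈ {1,2}` (number of real components) on the right:
  `ϖ⁻ · [T¹]L⁻ · log_p(γ_cyc) · #E(ℚ)_tors² = α♭⁻¹ · c_∞(E) · s · Reg_p(E, Dh) · ∏_v c_v`.
PARI normalisation (census): `A′ = ellpadicL(E♭,p,n,[0,(p−1)/2],1) = ϖ·c_∞(E♭)·[T¹]L·log_p(γ_cyc)`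
(even) resp. `ϖ⁻·[T¹]L⁻·log_p(γ_cyc)` (odd), `h(P) = Reg_p(E, Dh)` for the generator, `C =
#Ш_an∏c/#T²`, `c_∞(E♭) = c_∞(E)`; survivor `A′/(h·C) = α♭⁻¹·c_∞(E)` ⟺ the identities above.
CANDIDATE relation (label of record: EVIDENCE — CANDIDATE; `#Ш` exponent UNDETERMINED since
`#Ш_an = 1` on the universe, pre-registered shape `s¹`; nothing 'confirms'); NOT a theorem ⇒
`@[conjecture]` (obligation node). PROVED below: the clause `L(0) = 0` (X4-1 + `L(E,1) = 0`), and
`[T¹]L ≠ 0 ⟺ Reg_p(E, Dh) ≠ 0` given the identity. Printed antecedents: Delbourgo 1998 §2.5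
BS-D(p)(ii) (conjecture); Delbourgo 2002 Thm. (B) (algebraic side, tree `Delbourgo2002.mainTheorem`);
Disegni 2017 Thm. B (`p`-adic Gross–Zagier, semistable over `K`); the comparison constant between
these normalisations is OPEN (RESIDUAL-MAP O7-ord) — the census pins it to `α♭⁻¹` in PARI's.
[cite: Delbourgo1998, §2.5 BS-D(p)(ii) (shape only; nothing asserted)]
[cite: MazurTateTeitelbaum1986Invent, §I.13] -/
@[conjecture]
def RelationAt (W : WeierstrassCurve ℚ) [W.IsElliptic] [W.IsGloballyMinimal] (p : ℕ) [Fact p.Prime]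
    (Dh : PAdicHeightData W p) : Prop :=
  ∀ (V : WeierstrassCurve ℚ) [V.IsElliptic] [V.IsGloballyMinimal] (C : VariableChange ℚ)
    {N : ℕ} [NeZero N] (f : CuspForm (Gamma0 N) 2),
    Addv W p → (Good V p ∨ Mult V p) → IsNewformOf V f → W.analyticRank = 1 →
    ∀ s : ℚ, shaAn W = (s : ℂ) →
    -- rows `p ≡ 1 (mod 4)`: `p* = p`, even branch
    (p % 4 = 1 → C • V.quadraticTwist (p : ℚ) = W → ∀ ϖ : ℚ,
      (ϖ : ℝ) * V.realPeriodRat = plusPeriod f →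
        (IsOrdinaryAt V p →
          PowerSeries.constantCoeff (padicLFunctionBranch f (unitRoot V p : ℚ_[p]) (p / 2)) = 0 ∧
          PowerSeries.coeff 1 (padicLFunctionBranch f (unitRoot V p : ℚ_[p]) (p / 2)) ≠ 0 ∧
          (ϖ : ℚ_[p]) * PowerSeries.coeff 1 (padicLFunctionBranch f (unitRoot V p : ℚ_[p]) (p / 2)) *
              padicLog p (cyclotomicGenerator p) * (W.torsionOrder : ℚ_[p]) ^ 2 =
            (unitRoot V p : ℚ_[p])⁻¹ * ((s : ℚ_[p]) * padicRegulator Dh * W.tamagawaProduct)) ∧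
        (Mult V p →
          PowerSeries.constantCoeff
              (padicLFunctionPlusBranchMult f ((V.LFunction p : ℤ) : ℚ_[p]) (p / 2)) = 0 ∧
          PowerSeries.coeff 1 (padicLFunctionPlusBranchMult f ((V.LFunction p : ℤ) : ℚ_[p]) (p / 2)) ≠ 0 ∧
          (ϖ : ℚ_[p]) *
                PowerSeries.coeff 1 (padicLFunctionPlusBranchMult f ((V.LFunction p : ℤ) : ℚ_[p]) (p / 2)) *
              padicLog p (cyclotomicGenerator p) * (W.torsionOrder : ℚ_[p]) ^ 2 =
            ((V.LFunction p : ℤ) : ℚ_[p])⁻¹ * ((s : ℚ_[p]) * padicRegulator Dh * W.tamagawaProduct))) ∧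
    -- rows `p ≡ 3 (mod 4)`: `p* = −p`, odd branch
    (p % 4 = 3 → C • V.quadraticTwist (-(p : ℚ)) = W → ∀ ϖ : ℚ,
      (ϖ : ℝ) * V.imaginaryPeriodRat = minusPeriod f →
        (IsOrdinaryAt V p →
          PowerSeries.constantCoeff (padicLFunctionMinusBranch f (unitRoot V p : ℚ_[p]) (p / 2)) = 0 ∧
          PowerSeries.coeff 1 (padicLFunctionMinusBranch f (unitRoot V p : ℚ_[p]) (p / 2)) ≠ 0 ∧
          (ϖ : ℚ_[p]) * PowerSeries.coeff 1 (padicLFunctionMinusBranch f (unitRoot V p : ℚ_[p]) (p / 2)) *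
              padicLog p (cyclotomicGenerator p) * (W.torsionOrder : ℚ_[p]) ^ 2 =
            (unitRoot V p : ℚ_[p])⁻¹ * ((W.baseChange ℝ).numRealComponents : ℚ_[p]) *
              ((s : ℚ_[p]) * padicRegulator Dh * W.tamagawaProduct)) ∧
        (Mult V p →
          PowerSeries.constantCoeff
              (padicLFunctionMinusBranchMult f ((V.LFunction p : ℤ) : ℚ_[p]) (p / 2)) = 0 ∧
          PowerSeries.coeff 1 (padicLFunctionMinusBranchMult f ((V.LFunction p : ℤ) : ℚ_[p]) (p / 2)) ≠ 0 ∧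
          (ϖ : ℚ_[p]) *
                PowerSeries.coeff 1 (padicLFunctionMinusBranchMult f ((V.LFunction p : ℤ) : ℚ_[p]) (p / 2)) *
              padicLog p (cyclotomicGenerator p) * (W.torsionOrder : ℚ_[p]) ^ 2 =
            ((V.LFunction p : ℤ) : ℚ_[p])⁻¹ * ((W.baseChange ℝ).numRealComponents : ℚ_[p]) *
              ((s : ℚ_[p]) * padicRegulator Dh * W.tamagawaProduct)))

/-! ### §2 What is a theorem: the vanishing at `T = 0`, and the order clause versus `Reg_p ≠ 0` -/

section Theorems

variable (p : ℕ) [hp : Fact p.Prime]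

/-- **Clause `L(0) = 0` is a THEOREM on every row** (`p ≡ 1 (mod 4)`, (G-ord)): the constant term
is `α♭⁻¹ · ∑(a/p)[a/p]⁺_{f♭}` (X4-1, `constantCoeff_padicLFunctionBranch_half`) and the sum vanishes
with `L(E,1)` (`legendrePlusSymbolSum_eq_zero_of_entireLFunction_one_eq_zero`). Census: the branch
VALUE is `O(pⁿ)` on 700/700 rank-1 rows. [cite: MazurTateTeitelbaum1986Invent, §I.8 (8.6), §I.13] -/
theorem constantCoeff_branch_eq_zero_of_good (hmod : hasEntireLFunction_rat) (hp4 : p % 4 = 1)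
    (V W : WeierstrassCurve ℚ) [V.IsElliptic] [V.IsGloballyMinimal] [W.IsElliptic]
    [W.IsGloballyMinimal] (C : VariableChange ℚ) (hC : C • V.quadraticTwist (p : ℚ) = W)
    (hord : IsOrdinaryAt V p) (hadd : Addv W p) {N : ℕ} [NeZero N] {f : CuspForm (Gamma0 N) 2}
    (hf : IsNewformOf V f) (ϖ : ℚ) (hϖ : (ϖ : ℝ) * V.realPeriodRat = plusPeriod f)
    (hr : W.analyticRank ≠ 0) :
    PowerSeries.constantCoeff (padicLFunctionBranch f (unitRoot V p : ℚ_[p]) (p / 2)) = 0 := by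
  have hp2 : p ≠ 2 := by omega
  rw [constantCoeff_padicLFunctionBranch_half p hp2 V hord hf,
    legendrePlusSymbolSum_eq_zero_of_entireLFunction_one_eq_zero p hmod hp4 V W C hC
      (Or.inl hord.1) hadd hf ϖ hϖ (apply_eq_zero_of_analyticOrderNatAt_ne_zero hr),
    Rat.cast_zero, mul_zero]

/-- Clause `L(0) = 0`, rows `p ≡ 1 (mod 4)`, (M). [cite: MazurTateTeitelbaum1986Invent, §I.13] -/
theorem constantCoeff_branchMult_eq_zero (hmod : hasEntireLFunction_rat) (hp4 : p % 4 = 1)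
    (V W : WeierstrassCurve ℚ) [V.IsElliptic] [V.IsGloballyMinimal] [W.IsElliptic]
    [W.IsGloballyMinimal] (C : VariableChange ℚ) (hC : C • V.quadraticTwist (p : ℚ) = W)
    (hM : Mult V p) (hadd : Addv W p) {N : ℕ} [NeZero N] {f : CuspForm (Gamma0 N) 2}
    (hf : IsNewformOf V f) (ϖ : ℚ) (hϖ : (ϖ : ℝ) * V.realPeriodRat = plusPeriod f)
    (hr : W.analyticRank ≠ 0) :
    PowerSeries.constantCoeff
        (padicLFunctionPlusBranchMult f ((V.LFunction p : ℤ) : ℚ_[p]) (p / 2)) = 0 := by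
  have hp2 : p ≠ 2 := by omega
  obtain ⟨hap, hap0, hpN⟩ := cuspCoeff_eq_and_ne_zero_and_dvd_of_mult p hf hM
  rw [constantCoeff_padicLFunctionPlusBranchMult_half p hp2 hf.1 hf.coeffField_eq_bot hpN hap hap0,
    legendrePlusSymbolSum_eq_zero_of_entireLFunction_one_eq_zero p hmod hp4 V W C hC
      (Or.inr hM) hadd hf ϖ hϖ (apply_eq_zero_of_analyticOrderNatAt_ne_zero hr),
    Rat.cast_zero, mul_zero]

/-- Clause `L⁻(0) = 0`, rows `p ≡ 3 (mod 4)`, (G-ord). [cite: MazurTateTeitelbaum1986Invent, §I.13] -/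
theorem constantCoeff_minusBranch_eq_zero_of_good (hmod : hasEntireLFunction_rat) (hp4 : p % 4 = 3)
    (V W : WeierstrassCurve ℚ) [V.IsElliptic] [V.IsGloballyMinimal] [W.IsElliptic]
    [W.IsGloballyMinimal] (C : VariableChange ℚ) (hC : C • V.quadraticTwist (-(p : ℚ)) = W)
    (hord : IsOrdinaryAt V p) (hadd : Addv W p) {N : ℕ} [NeZero N] {f : CuspForm (Gamma0 N) 2}
    (hf : IsNewformOf V f) (ϖ : ℚ) (hϖ : (ϖ : ℝ) * V.imaginaryPeriodRat = minusPeriod f)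
    (hr : W.analyticRank ≠ 0) :
    PowerSeries.constantCoeff (padicLFunctionMinusBranch f (unitRoot V p : ℚ_[p]) (p / 2)) = 0 := by
  have hp2 : p ≠ 2 := by omega
  rw [constantCoeff_padicLFunctionMinusBranch_half p hp2 V hord hf,
    legendreMinusSymbolSum_eq_zero_of_entireLFunction_one_eq_zero p hmod hp4 V W C hC
      (Or.inl hord.1) hadd hf ϖ hϖ (apply_eq_zero_of_analyticOrderNatAt_ne_zero hr),
    Rat.cast_zero, mul_zero]

/-- Clause `L⁻(0) = 0`, rows `p ≡ 3 (mod 4)`, (M). [cite: MazurTateTeitelbaum1986Invent, §I.13] -/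
theorem constantCoeff_minusBranchMult_eq_zero (hmod : hasEntireLFunction_rat) (hp4 : p % 4 = 3)
    (V W : WeierstrassCurve ℚ) [V.IsElliptic] [V.IsGloballyMinimal] [W.IsElliptic]
    [W.IsGloballyMinimal] (C : VariableChange ℚ) (hC : C • V.quadraticTwist (-(p : ℚ)) = W)
    (hM : Mult V p) (hadd : Addv W p) {N : ℕ} [NeZero N] {f : CuspForm (Gamma0 N) 2}
    (hf : IsNewformOf V f) (ϖ : ℚ) (hϖ : (ϖ : ℝ) * V.imaginaryPeriodRat = minusPeriod f)
    (hr : W.analyticRank ≠ 0) :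
    PowerSeries.constantCoeff
        (padicLFunctionMinusBranchMult f ((V.LFunction p : ℤ) : ℚ_[p]) (p / 2)) = 0 := by
  have hp2 : p ≠ 2 := by omega
  obtain ⟨hap, hap0, hpN⟩ := cuspCoeff_eq_and_ne_zero_and_dvd_of_mult p hf hM
  rw [constantCoeff_padicLFunctionMinusBranchMult_half p hp2 hf.1 hf.coeffField_eq_bot hpN hap hap0,
    legendreMinusSymbolSum_eq_zero_of_entireLFunction_one_eq_zero p hmod hp4 V W C hC
      (Or.inr hM) hadd hf ϖ hϖ (apply_eq_zero_of_analyticOrderNatAt_ne_zero hr),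
    Rat.cast_zero, mul_zero]

/-- **Given the identity, `[T¹]L ≠ 0 ⟺ Reg_p(E, Dh) ≠ 0`** (pure bookkeeping: `ϖ ≠ 0`,
`log_p γ_cyc ≠ 0` (`padicLog_cyclotomicGenerator_ne_zero`), `#T ≠ 0`, `∏c ≠ 0`, `s ≠ 0`, `u ≠ 0`).
So the census's `A′ ≠ 0` on 700/700 is, given the identity, the per-pair Schneider certificate
`h(P) ≠ 0` (700/700), and conversely. [cite: MazurTateTeitelbaum1986Invent, §I.13] -/
theorem coeff_one_ne_zero_iff_padicRegulator_ne_zero {W : WeierstrassCurve ℚ} [W.IsElliptic]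
    (Dh : PAdicHeightData W p) {c u κ : ℚ_[p]} (hu : u ≠ 0) (hκ : κ ≠ 0) {ϖ s : ℚ} (hϖ0 : ϖ ≠ 0)
    (hs0 : s ≠ 0)
    (hid : (ϖ : ℚ_[p]) * c * padicLog p (cyclotomicGenerator p) * (W.torsionOrder : ℚ_[p]) ^ 2 =
      u * κ * ((s : ℚ_[p]) * padicRegulator Dh * W.tamagawaProduct)) :
    c ≠ 0 ↔ padicRegulator Dh ≠ 0 := by
  have hϖ : (ϖ : ℚ_[p]) ≠ 0 := by exact_mod_cast hϖ0
  have hlog := padicLog_cyclotomicGenerator_ne_zero p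
  have hT : (W.torsionOrder : ℚ_[p]) ^ 2 ≠ 0 :=
    pow_ne_zero 2 (by exact_mod_cast (W.torsionOrder_pos_holds).ne')
  have hs : (s : ℚ_[p]) ≠ 0 := by exact_mod_cast hs0
  have hc : (W.tamagawaProduct : ℚ_[p]) ≠ 0 := by
    exact_mod_cast (W.tamagawaProduct_pos_holds : 0 < W.tamagawaProduct).ne'
  constructor
  · intro h1 hR
    rw [hR, mul_zero, zero_mul, mul_zero] at hid
    exact (mul_ne_zero (mul_ne_zero (mul_ne_zero hϖ h1) hlog) hT) hid
  · intro hR h1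
    rw [h1, mul_zero, zero_mul, zero_mul] at hid
    exact (mul_ne_zero (mul_ne_zero hu hκ) (mul_ne_zero (mul_ne_zero hs hR) hc)) hid.symm

end Theorems

end CensusX42

end Summit.BirchSwinnertonDyer.Rank1Residual.Additive

end
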